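import Literature.AlgebraicGeometry.Frobenioids.Cor54AsPrinted
import Literature.AlgebraicGeometry.Frobenioids.Cor54SubStrongUniqueReduction
import Literature.AlgebraicGeometry.Frobenioids.FrobenioidRealificationCor54Schema
import Literature.AlgebraicGeometry.Frobenioids.Cor54RigidityArithMorphisms
import Literature.AlgebraicGeometry.Frobenioids.Prop55Sub
import HarnessLib

/-!
# Frobenioids I, Corollary 5.4: the typed statement `PreFrobenioid.Cor54` AT THE DATA — for every pair of
# Frobenioids modulo rigidity along `C₁^un-tr → C₁^rlf`, and UNCONDITIONALLY at `C₁ = C_{K/F}`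

Mochizuki, *The geometry of Frobenioids I: the general theory*, Kyushu J. Math. **62** (2008) 293–400,
Cor. 5.4, kurims p. 103 l. 37 – p. 104 l. 9 ("there exists a 1-unique functor `Ψ^rlf : C₁^rlf → C₂^rlf` that
fits into a 1-commutative diagram … [where the vertical arrows are the natural functors of Proposition 5.3;
the horizontal arrows are equivalences of categories]. Moreover, each of the composite functors of this
diagram is rigid."), proof p. 104 ll. 21–24. [cite: MochizukiFrdI2008, Cor. 5.4 p.104]

PROOF-ONLY file (cell abc-iut, layer L1, seat abc-iut-L1-t10 gen 4, row «C54-AS-PRINTED KNIT»).  The typed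
statement of record for Cor. 5.4 is seat abc-iut-L1-t5's SCHEMA `PreFrobenioid.Cor54 F₁ F₂ Rp₁ Rp₂ R₁ R₂ ι₁ ι₂ Ψ`
(`FrobenioidRealification.lean`; FACT-LIST row F-1093), over PARAMETERS `Rp_i` (Def. 4.5 (iii)), realification
data `R_i` and "the natural functors of Proposition 5.3" `ι_i : C_i → C_i^rlf`; its universal closure is false
at junk `ι_i` (seat abc-iut-f-040's `not_forall_cor54`), and it renders "1-unique" by the STRONG clause "every
functor fitting the square is `≅ Ψ^rlf`".  This file proves the schema AT THE DATA — `Rp_i :=` THE parameters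
`PreFrobenioid.rsParams` (seat abc-iut-L6-t10), `R_i :=` THE realification data `RealificationData.canonical`
(seat abc-iut-L1-d2, so `realification F_i R_i` is THE `C_i^rlf = PreFrobenioid.rlf F_i hΦ_i`), `ι_i :=` print's
vertical arrows `C_i → C_i^istr → C_i^rlf` (isotropification of Prop. 1.9 (v), seat abc-iut-L1-t1, then THE
`FrdI.Prop53Sub.iotaRlf` of seat abc-iut-w5-d137 at THE comparison equivalence `untrComparison`):

* `nonempty_iso_of_leftAdjoint_comp_iso` — whiskering along a REFLECTOR reflects isomorphisms of functors
  (`L ⋙ T ≅ L ⋙ T' ⟹ T ≅ T'`; Mathlib `Adjunction.isLocalization` + `Localization.fullyFaithfulWhiskeringLeft`);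
* `FrdI.Cor54Sub.square_of_printedSquare` — a functor `Ψ' : C₁^rlf → C₂^rlf` fitting print's square FROM
  `C_i` fits the square of row C54/L06 from `C_i^istr` (cancel the reflector `C₁ → C₁^istr` against the square
  of Thm. 3.4 (i), this seat's `oneCommutes_isotropification_of_restricts`);
* `PreFrobenioid.cor54_atData_of_rigidAlong` — **the typed `Cor54` AT THE DATA for EVERY pair of Frobenioids with
  perf-factorial `Φ_i`, modulo ONE displayed binder `hrig`**: rigidity of THE `C₁^rlf` along THE model-level
  realification functor `untrToRlf F₁ hΦ₁ : C₁^un-tr → C₁^rlf` (every endofunctor `T` with `untrToRlf ⋙ T ≅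
  untrToRlf` is `≅ 𝟭`) — the reduction of the strong clause by seat abc-iut-w5-d227
  (`strongUnique_of_rigidAlong_untrToRlf`, whose docstring records that `hrig` needs the "rationally standard"
  hypothesis: it fails for the model of `(ℝ≥0, 0)` over a point via the floor functor); existence, equivalence,
  the square and the rigidity of the composites from this seat's `FrdI.Cor54Sub.cor54_ofFunctor_square` (all of
  Cor. 4.10 / 4.11 (i)–(iv) BY NAME, in print's generality); the schema's hypothesis `PreservesBaseIsoIfGroupLike`
  is seat abc-iut-L1-t3's `HypB` (seat abc-iut-f-040's junction `preservesBaseIsoIfGroupLike_iff_hypB`);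
* `PreFrobenioid.cor54_atData_arith` — **the typed `Cor54` AT THE DATA, UNCONDITIONALLY, for `C₁ = C_{K/F}`**
  (THE arithmetic Frobenioid of Ex. 6.3 / Thm. 6.4, `K/F` Galois) and EVERY Frobenioid `C₂` with perf-factorial
  `Φ₂`: `hrig` is seat abc-iut-w5-d227's `FrdI.Cor54Sub.hrig_arith` (`Cor54RigidityArithMorphisms.lean`, rows
  C54-core-arith (1)–(4) of seats abc-iut-w5-d048 / L1-d8 / L1-d9 / L1-d2);
* `PreFrobenioid.cor54_conclusion_arith` — for `Ψ : C_{K₁/F₁} ⥲ C_{K₂/F₂}` the CONCLUSION of the typed `Cor54`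
  outright, its nine antecedents discharged BY NAME (`arithFrobenioid_isFrobenioid`, `arith_ofFunctor_isDivSlim`,
  `arithFrobenioid_isOfRationallyStandardType_rsParams`, `preservesBaseIsoIfGroupLike_arith`): ∃ `Ψ^rlf`, the
  printed square, equivalence, STRONG 1-uniqueness, both composites rigid — no binder at all.

No definition, no new notion; no statement of the paper is restated or strengthened; the honest scope of the
general case is the displayed binder `hrig`.  [FrdI] is a refereed prerequisite paper — nothing here bears on
[IUTchIII] Cor. 3.12; typed ≠ proved elsewhere, here PROVED = kernel-checked.
-/

namespace Literature.AlgebraicGeometry.Frobenioids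

open CategoryTheory Opposite

universe w v v' u u' v₁ u₁ v₂ u₂ v₃ u₃

/-! ### Whiskering along a reflector reflects isomorphisms of functors -/

section Reflector

variable {P : Type u₁} [Category.{v₁} P] {Q : Type u₂} [Category.{v₂} Q] {Z : Type u₃} [Category.{v₃} Z]

/-- For a REFLECTOR `L : P → Q` (left adjoint with fully faithful right adjoint, e.g. `C → C^istr` of
Prop. 1.9 (v)) and functors `T, T' : Q → Z`: `L ⋙ T ≅ L ⋙ T'` implies `T ≅ T'` — `L` is a localization
(Mathlib `Adjunction.isLocalization`), so whiskering along it is fully faithful (FrdI §0 p. 15, "1-commutative";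
used to pass from print's square from `C_i` to the square from `C_i^istr`). [cite: MochizukiFrdI2008, §0 p.15] -/
theorem nonempty_iso_of_leftAdjoint_comp_iso {L : P ⥤ Q} {R : Q ⥤ P} (adj : L ⊣ R) [R.Full] [R.Faithful]
    {T T' : Q ⥤ Z} (e : L ⋙ T ≅ L ⋙ T') : Nonempty (T ≅ T') := by
  haveI := adj.isLocalization
  exact ⟨(Localization.fullyFaithfulWhiskeringLeft L ((MorphismProperty.isomorphisms Q).inverseImage L) Z).preimageIso e⟩

end Reflector

namespace FrdI.Cor54Sub

open PreFrobenioidData (ofFunctor)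
open PreFrobenioid

variable {D₁ : Type u} [Category.{v} D₁] {Φ₁ : D₁ᵒᵖ ⥤ CommMonCat.{w}} {C₁ : Type u'} [Category.{v'} C₁]
  {D₂ : Type u} [Category.{v} D₂] {Φ₂ : D₂ᵒᵖ ⥤ CommMonCat.{w}} {C₂ : Type u'} [Category.{v'} C₂]
  {F₁ : C₁ ⥤ ElemFrobenioid Φ₁} {F₂ : C₂ ⥤ ElemFrobenioid Φ₂}
  (hΦ₁ : IsPerfFactorialOn Φ₁) (hΦ₂ : IsPerfFactorialOn Φ₂)

/-- **From print's square (vertical arrows from `C_i`) to the square of row C54/L06 (from `C_i^istr`)**: for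
Frobenioids of quasi-isotropic type, an equivalence `Ψ`, a restriction `Ψ^istr` of `Ψ` and ANY comparison
equivalences `e_i`, every `Ψ' : C₁^rlf → C₂^rlf` with `Ψ ⋙ (C₂ → C₂^istr → C₂^rlf) ≅ (C₁ → C₁^istr → C₁^rlf) ⋙ Ψ'`
satisfies `ι₁ ⋙ Ψ' ≅ Ψ^istr ⋙ ι₂` — paste with the square of Thm. 3.4 (i)
(`oneCommutes_isotropification_of_restricts`) and cancel the reflector `C₁ → C₁^istr`
(`nonempty_iso_of_leftAdjoint_comp_iso`). [cite: MochizukiFrdI2008, Cor. 5.4 p.104] -/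
theorem square_of_printedSquare (hF₁ : IsFrobenioid F₁) (hF₂ : IsFrobenioid F₂)
    (hq₁ : (ofFunctor Φ₁ F₁).IsOfQuasiIsotropicType) (hq₂ : (ofFunctor Φ₂ F₂).IsOfQuasiIsotropicType)
    (Ψ : C₁ ≌ C₂) (Ψistr : (ofFunctor Φ₁ F₁).Istr ⥤ (ofFunctor Φ₂ F₂).Istr)
    (hΨistr : Ψistr ⋙ (ofFunctor Φ₂ F₂).istrι ≅ (ofFunctor Φ₁ F₁).istrι ⋙ Ψ.functor)
    (e₁ : (ofFunctor Φ₁ F₁).Untr ≌ untrModel F₁) (e₂ : (ofFunctor Φ₂ F₂).Untr ≌ untrModel F₂)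
    (Ψ' : rlf F₁ hΦ₁ ⥤ rlf F₂ hΦ₂)
    (h : OneCommutes Ψ.functor
      ((isotropification hF₂ ⋙ ObjectProperty.ιOfLE (isotropicObjects_le_ofFunctor F₂)) ⋙
        FrdI.Prop53Sub.iotaRlf F₂ hΦ₂ e₂)
      ((isotropification hF₁ ⋙ ObjectProperty.ιOfLE (isotropicObjects_le_ofFunctor F₁)) ⋙
        FrdI.Prop53Sub.iotaRlf F₁ hΦ₁ e₁)
      Ψ') :
    Square hΦ₁ hΦ₂ Ψistr e₁ e₂ Ψ' := by
  obtain ⟨top⟩ := oneCommutes_isotropification_of_restricts hF₁ hF₂ hq₁ hq₂ Ψ Ψistr hΨistr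
  obtain ⟨sq⟩ := h
  -- the comparison `Istr F₁ ⥤ (ofFunctor Φ₁ F₁).Istr` is an equivalence; the reflector `C₁ → C₁^istr`
  haveI : (ObjectProperty.ιOfLE (isotropicObjects_le_ofFunctor F₁)).IsEquivalence :=
    (ObjectProperty.isEquivalence_ιOfLE_iff _).2
      (le_trans (isotropicObjects_ofFunctor_le F₁) (ObjectProperty.le_isoClosure _))
  let adj : isotropification hF₁ ⋙ ObjectProperty.ιOfLE (isotropicObjects_le_ofFunctor F₁) ⊣
      (ObjectProperty.ιOfLE (isotropicObjects_le_ofFunctor F₁)).asEquivalence.inverse ⋙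
        (isotropicObjects F₁).ι :=
    (isotropificationAdjunction hF₁).comp
      (ObjectProperty.ιOfLE (isotropicObjects_le_ofFunctor F₁)).asEquivalence.toAdjunction
  -- `(C₁ → C₁^istr) ⋙ (ι₁ ⋙ Ψ') ≅ (C₁ → C₁^istr) ⋙ (Ψ^istr ⋙ ι₂)`
  let c : (isotropification hF₁ ⋙ ObjectProperty.ιOfLE (isotropicObjects_le_ofFunctor F₁)) ⋙
        (FrdI.Prop53Sub.iotaRlf F₁ hΦ₁ e₁ ⋙ Ψ') ≅
      (isotropification hF₁ ⋙ ObjectProperty.ιOfLE (isotropicObjects_le_ofFunctor F₁)) ⋙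
        (Ψistr ⋙ FrdI.Prop53Sub.iotaRlf F₂ hΦ₂ e₂) :=
    (Functor.associator _ _ _).symm ≪≫ sq.symm ≪≫ (Functor.associator _ _ _).symm ≪≫
      Functor.isoWhiskerRight top _ ≪≫ Functor.associator _ _ _
  obtain ⟨i⟩ := nonempty_iso_of_leftAdjoint_comp_iso adj c
  exact ⟨i⟩

end FrdI.Cor54Sub

namespace PreFrobenioid

open PreFrobenioidData (ofFunctor)

section General

variable {D₁ : Type u} [Category.{v} D₁] {Φ₁ : D₁ᵒᵖ ⥤ CommMonCat.{w}} {C₁ : Type u'} [Category.{v'} C₁]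
  {D₂ : Type u} [Category.{v} D₂] {Φ₂ : D₂ᵒᵖ ⥤ CommMonCat.{w}} {C₂ : Type u'} [Category.{v'} C₂]
  (F₁ : C₁ ⥤ ElemFrobenioid Φ₁) (F₂ : C₂ ⥤ ElemFrobenioid Φ₂)
  (hΦ₁ : IsPerfFactorialOn Φ₁) (hΦ₂ : IsPerfFactorialOn Φ₂)

set_option backward.isDefEq.respectTransparency false in
/-- **[FrdI] Cor. 5.4 — the typed `PreFrobenioid.Cor54` AT THE DATA, for every pair of Frobenioids with
perf-factorial `Φ_i` and every equivalence `Ψ`, modulo rigidity of THE `C₁^rlf` along `C₁^un-tr → C₁^rlf`.**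
Data: `Rp_i :=` THE parameters of Def. 4.5 (iii) (`rsParams`), `R_i :=` THE realification data
(`RealificationData.canonical`), `ι_i :=` print's vertical arrows `C_i → C_i^istr → C_i^rlf`.  Given the schema's
own antecedents (Frobenioids, `Φ_i` perf-factorial, `D_i` Div-slim, `C_i` of rationally standard type,
base-isomorphisms preserved in the group-like case): THERE EXISTS `Ψ^rlf` fitting print's square, an
EQUIVALENCE, `1`-UNIQUE IN THE STRONG SENSE (every functor fitting the square is `≅ Ψ^rlf`), with BOTH composites
`C₁ → C₂^rlf` RIGID.  Composition of this seat's `FrdI.Cor54Sub.cor54_ofFunctor_square` (Cor. 4.10 / 4.11 by name)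
with seat abc-iut-w5-d227's reduction `strongUnique_of_rigidAlong_untrToRlf` of the strong clause to `hrig`.
[cite: MochizukiFrdI2008, Cor. 5.4 p.104] -/
theorem cor54_atData_of_rigidAlong (hF₁ : IsFrobenioid F₁) (hF₂ : IsFrobenioid F₂)
    (hrig : ∀ T : rlf F₁ hΦ₁ ⥤ rlf F₁ hΦ₁,
      Nonempty (untrToRlf F₁ hΦ₁ ⋙ T ≅ untrToRlf F₁ hΦ₁) → Nonempty (T ≅ 𝟭 _))
    (Ψ : C₁ ≌ C₂) :
    Cor54 F₁ F₂ (rsParams hF₁ fun a 𝔭 => PrimarySupp a 𝔭) (rsParams hF₂ fun a 𝔭 => PrimarySupp a 𝔭)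
      (RealificationData.canonical Φ₁ (IsPerfFactorialOn.op hΦ₁))
      (RealificationData.canonical Φ₂ (IsPerfFactorialOn.op hΦ₂))
      ((isotropification hF₁ ⋙ ObjectProperty.ιOfLE (isotropicObjects_le_ofFunctor F₁)) ⋙
        FrdI.Prop53Sub.iotaRlf F₁ hΦ₁ (untrComparison F₁ hF₁))
      ((isotropification hF₂ ⋙ ObjectProperty.ιOfLE (isotropicObjects_le_ofFunctor F₂)) ⋙
        FrdI.Prop53Sub.iotaRlf F₂ hΦ₂ (untrComparison F₂ hF₂))
      Ψ := by
  intro _ _ _ _ hD₁ hD₂ hrs₁ hrs₂ hP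
  have hs : (ofFunctor Φ₁ F₁).Cor411Setting (ofFunctor Φ₂ F₂) Ψ :=
    ⟨⟨hD₁, hD₂⟩, ⟨hrs₁.standard, hrs₂.standard⟩, (preservesBaseIsoIfGroupLike_iff_hypB F₁ F₂ Ψ).1 hP⟩
  obtain ⟨Ψi, Ψrlf, hΨi, hequiv, hsqI, hsq, hr₁, hr₂⟩ := FrdI.Cor54Sub.cor54_ofFunctor_square F₁ F₂ hΦ₁ hΦ₂
    hF₁ hF₂ hrs₁.rational Ψ hs
  haveI := hequiv
  refine ⟨Ψrlf, ⟨hsq.some.symm⟩, hequiv, fun Ψ' hΨ' => ?_, hr₁, hr₂⟩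
  have hsq' : FrdI.Cor54Sub.Square hΦ₁ hΦ₂ Ψi.functor (untrComparison F₁ hF₁) (untrComparison F₂ hF₂) Ψ' :=
    FrdI.Cor54Sub.square_of_printedSquare hΦ₁ hΦ₂ hF₁ hF₂ hs.standard.1.quasiIsotropic
      hs.standard.2.quasiIsotropic Ψ Ψi.functor (eqToIso hΨi) (untrComparison F₁ hF₁) (untrComparison F₂ hF₂)
      Ψ' ⟨hΨ'.some.symm⟩
  exact FrdI.Cor54Sub.strongUnique_of_rigidAlong_untrToRlf hΦ₁ hΦ₂ Ψi.functor (untrComparison F₁ hF₁)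
    (untrComparison F₂ hF₂) Ψrlf hsqI hrig Ψ' hsq'

end General

/-! ### At `C₁ = C_{K/F}`: unconditionally -/

section Arith

variable {F₁ : Type} [Field F₁] [NumberField F₁] {K₁ : Type} [Field K₁] [Algebra F₁ K₁] [IsGalois F₁ K₁]
  (hΦ₁ : IsPerfFactorialOn (arithDivisorFunctor F₁ K₁))

set_option backward.isDefEq.respectTransparency false in
/-- **[FrdI] Cor. 5.4 — the typed `PreFrobenioid.Cor54` AT THE DATA, UNCONDITIONALLY, for `C₁ = C_{K/F}`** (THE
arithmetic Frobenioid of Ex. 6.3 / Thm. 6.4, `K/F` Galois) and every Frobenioid `C₂` with perf-factorial `Φ₂`,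
every equivalence `Ψ : C_{K/F} ⥲ C₂`: the rigidity of `C_{K/F}^rlf` along `C_{K/F}^un-tr → C_{K/F}^rlf` is seat
abc-iut-w5-d227's `FrdI.Cor54Sub.hrig_arith`. [cite: MochizukiFrdI2008, Cor. 5.4 p.104] -/
theorem cor54_atData_arith {D₂ : Type} [Category.{0} D₂] {Φ₂ : D₂ᵒᵖ ⥤ CommMonCat.{0}} {C₂ : Type}
    [Category.{0} C₂] (F₂ : C₂ ⥤ ElemFrobenioid Φ₂) (hΦ₂ : IsPerfFactorialOn Φ₂) (hF₂ : IsFrobenioid F₂)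
    (Ψ : arithFrobenioid F₁ K₁ ≌ C₂) :
    Cor54 (ModelFrobenioid.toElem (arithDivisorFunctor F₁ K₁) (unitsFunctor F₁ K₁) (divNatTrans F₁ K₁)) F₂
      (rsParams (arithFrobenioid_isFrobenioid F₁ K₁) fun a 𝔭 => PrimarySupp a 𝔭)
      (rsParams hF₂ fun a 𝔭 => PrimarySupp a 𝔭)
      (RealificationData.canonical (arithDivisorFunctor F₁ K₁) (IsPerfFactorialOn.op hΦ₁))
      (RealificationData.canonical Φ₂ (IsPerfFactorialOn.op hΦ₂))
      ((isotropification (arithFrobenioid_isFrobenioid F₁ K₁) ⋙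
          ObjectProperty.ιOfLE (isotropicObjects_le_ofFunctor
            (ModelFrobenioid.toElem (arithDivisorFunctor F₁ K₁) (unitsFunctor F₁ K₁) (divNatTrans F₁ K₁)))) ⋙
        FrdI.Prop53Sub.iotaRlf (ModelFrobenioid.toElem (arithDivisorFunctor F₁ K₁) (unitsFunctor F₁ K₁)
          (divNatTrans F₁ K₁)) hΦ₁
          (untrComparison (ModelFrobenioid.toElem (arithDivisorFunctor F₁ K₁) (unitsFunctor F₁ K₁)
            (divNatTrans F₁ K₁)) (arithFrobenioid_isFrobenioid F₁ K₁)))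
      ((isotropification hF₂ ⋙ ObjectProperty.ιOfLE (isotropicObjects_le_ofFunctor F₂)) ⋙
        FrdI.Prop53Sub.iotaRlf F₂ hΦ₂ (untrComparison F₂ hF₂))
      Ψ :=
  cor54_atData_of_rigidAlong _ F₂ hΦ₁ hΦ₂ (arithFrobenioid_isFrobenioid F₁ K₁) hF₂
    (FrdI.Cor54Sub.hrig_arith hΦ₁) Ψ

variable {F₂ : Type} [Field F₂] [NumberField F₂] {K₂ : Type} [Field K₂] [Algebra F₂ K₂] [IsGalois F₂ K₂]
  (hΦ₂ : IsPerfFactorialOn (arithDivisorFunctor F₂ K₂))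

set_option backward.isDefEq.respectTransparency false in
/-- **[FrdI] Cor. 5.4 AT `Ψ : C_{K₁/F₁} ⥲ C_{K₂/F₂}` — THE CONCLUSION OUTRIGHT, no binder**: the nine antecedents
of the typed `Cor54` are discharged BY NAME at THE arithmetic Frobenioids (`arithFrobenioid_isFrobenioid`,
perf-factorial `Φ`, seat abc-iut-f-040's `arith_ofFunctor_isDivSlim` / `preservesBaseIsoIfGroupLike_arith`, seat
abc-iut-L6-t10's `arithFrobenioid_isOfRationallyStandardType_rsParams`), so: THERE EXISTS
`Ψ^rlf : C_{K₁/F₁}^rlf → C_{K₂/F₂}^rlf` fitting print's square `(C₁ → C₁^istr → C₁^rlf) ⋙ Ψ^rlf ≅ Ψ ⋙ (C₂ → C₂^istr →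
C₂^rlf)`, an EQUIVALENCE, `1`-UNIQUE in the strong sense, with both composite functors RIGID.
[cite: MochizukiFrdI2008, Cor. 5.4 p.104] -/
theorem cor54_conclusion_arith (Ψ : arithFrobenioid F₁ K₁ ≌ arithFrobenioid F₂ K₂) :
    ∃ Ψrlf : rlf (ModelFrobenioid.toElem (arithDivisorFunctor F₁ K₁) (unitsFunctor F₁ K₁) (divNatTrans F₁ K₁)) hΦ₁ ⥤
        rlf (ModelFrobenioid.toElem (arithDivisorFunctor F₂ K₂) (unitsFunctor F₂ K₂) (divNatTrans F₂ K₂)) hΦ₂,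
      Nonempty
          (((isotropification (arithFrobenioid_isFrobenioid F₁ K₁) ⋙
              ObjectProperty.ιOfLE (isotropicObjects_le_ofFunctor
                (ModelFrobenioid.toElem (arithDivisorFunctor F₁ K₁) (unitsFunctor F₁ K₁) (divNatTrans F₁ K₁)))) ⋙
            FrdI.Prop53Sub.iotaRlf (ModelFrobenioid.toElem (arithDivisorFunctor F₁ K₁) (unitsFunctor F₁ K₁)
              (divNatTrans F₁ K₁)) hΦ₁
              (untrComparison (ModelFrobenioid.toElem (arithDivisorFunctor F₁ K₁) (unitsFunctor F₁ K₁)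
                (divNatTrans F₁ K₁)) (arithFrobenioid_isFrobenioid F₁ K₁))) ⋙ Ψrlf ≅
          Ψ.functor ⋙
            ((isotropification (arithFrobenioid_isFrobenioid F₂ K₂) ⋙
              ObjectProperty.ιOfLE (isotropicObjects_le_ofFunctor
                (ModelFrobenioid.toElem (arithDivisorFunctor F₂ K₂) (unitsFunctor F₂ K₂) (divNatTrans F₂ K₂)))) ⋙
            FrdI.Prop53Sub.iotaRlf (ModelFrobenioid.toElem (arithDivisorFunctor F₂ K₂) (unitsFunctor F₂ K₂)
              (divNatTrans F₂ K₂)) hΦ₂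
              (untrComparison (ModelFrobenioid.toElem (arithDivisorFunctor F₂ K₂) (unitsFunctor F₂ K₂)
                (divNatTrans F₂ K₂)) (arithFrobenioid_isFrobenioid F₂ K₂)))) ∧
        Ψrlf.IsEquivalence ∧
        (∀ Ψ' : rlf (ModelFrobenioid.toElem (arithDivisorFunctor F₁ K₁) (unitsFunctor F₁ K₁) (divNatTrans F₁ K₁)) hΦ₁ ⥤
            rlf (ModelFrobenioid.toElem (arithDivisorFunctor F₂ K₂) (unitsFunctor F₂ K₂) (divNatTrans F₂ K₂)) hΦ₂,
          Nonempty
              (((isotropification (arithFrobenioid_isFrobenioid F₁ K₁) ⋙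
                  ObjectProperty.ιOfLE (isotropicObjects_le_ofFunctor
                    (ModelFrobenioid.toElem (arithDivisorFunctor F₁ K₁) (unitsFunctor F₁ K₁)
                      (divNatTrans F₁ K₁)))) ⋙
                FrdI.Prop53Sub.iotaRlf (ModelFrobenioid.toElem (arithDivisorFunctor F₁ K₁) (unitsFunctor F₁ K₁)
                  (divNatTrans F₁ K₁)) hΦ₁
                  (untrComparison (ModelFrobenioid.toElem (arithDivisorFunctor F₁ K₁) (unitsFunctor F₁ K₁)
                    (divNatTrans F₁ K₁)) (arithFrobenioid_isFrobenioid F₁ K₁))) ⋙ Ψ' ≅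
              Ψ.functor ⋙
                ((isotropification (arithFrobenioid_isFrobenioid F₂ K₂) ⋙
                  ObjectProperty.ιOfLE (isotropicObjects_le_ofFunctor
                    (ModelFrobenioid.toElem (arithDivisorFunctor F₂ K₂) (unitsFunctor F₂ K₂)
                      (divNatTrans F₂ K₂)))) ⋙
                FrdI.Prop53Sub.iotaRlf (ModelFrobenioid.toElem (arithDivisorFunctor F₂ K₂) (unitsFunctor F₂ K₂)
                  (divNatTrans F₂ K₂)) hΦ₂
                  (untrComparison (ModelFrobenioid.toElem (arithDivisorFunctor F₂ K₂) (unitsFunctor F₂ K₂)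
                    (divNatTrans F₂ K₂)) (arithFrobenioid_isFrobenioid F₂ K₂)))) →
            Nonempty (Ψ' ≅ Ψrlf)) ∧
        IsRigidFunctor
            (((isotropification (arithFrobenioid_isFrobenioid F₁ K₁) ⋙
                ObjectProperty.ιOfLE (isotropicObjects_le_ofFunctor
                  (ModelFrobenioid.toElem (arithDivisorFunctor F₁ K₁) (unitsFunctor F₁ K₁) (divNatTrans F₁ K₁)))) ⋙
              FrdI.Prop53Sub.iotaRlf (ModelFrobenioid.toElem (arithDivisorFunctor F₁ K₁) (unitsFunctor F₁ K₁)
                (divNatTrans F₁ K₁)) hΦ₁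
                (untrComparison (ModelFrobenioid.toElem (arithDivisorFunctor F₁ K₁) (unitsFunctor F₁ K₁)
                  (divNatTrans F₁ K₁)) (arithFrobenioid_isFrobenioid F₁ K₁))) ⋙ Ψrlf) ∧
          IsRigidFunctor
            (Ψ.functor ⋙
              ((isotropification (arithFrobenioid_isFrobenioid F₂ K₂) ⋙
                ObjectProperty.ιOfLE (isotropicObjects_le_ofFunctor
                  (ModelFrobenioid.toElem (arithDivisorFunctor F₂ K₂) (unitsFunctor F₂ K₂) (divNatTrans F₂ K₂)))) ⋙
              FrdI.Prop53Sub.iotaRlf (ModelFrobenioid.toElem (arithDivisorFunctor F₂ K₂) (unitsFunctor F₂ K₂)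
                (divNatTrans F₂ K₂)) hΦ₂
                (untrComparison (ModelFrobenioid.toElem (arithDivisorFunctor F₂ K₂) (unitsFunctor F₂ K₂)
                  (divNatTrans F₂ K₂)) (arithFrobenioid_isFrobenioid F₂ K₂)))) :=
  cor54_atData_arith hΦ₁ _ hΦ₂ (arithFrobenioid_isFrobenioid F₂ K₂) Ψ
    (arithFrobenioid_isFrobenioid F₁ K₁) (arithFrobenioid_isFrobenioid F₂ K₂) hΦ₁ hΦ₂
    (arith_ofFunctor_isDivSlim F₁ K₁) (arith_ofFunctor_isDivSlim F₂ K₂)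
    (arithFrobenioid_isOfRationallyStandardType_rsParams F₁ K₁)
    (arithFrobenioid_isOfRationallyStandardType_rsParams F₂ K₂)
    (preservesBaseIsoIfGroupLike_arith (Ψ := Ψ))

end Arith

end PreFrobenioid

end Literature.AlgebraicGeometry.Frobenioids
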